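import Summits.HodgeConjecture.HodgeConjecture.Theses.PadicSemiregularLift
import Summits.HodgeConjecture.HodgeConjecture.Theorems.PadicSemiregularLiftFermatAnchorAssemblyOfChildren
import Literature.AlgebraicGeometry.Motives.JacobianDimensionBettiProofs

/-!
# Line `cm-sector-transfer` — skeleton for crux `FermatAnchorAssembly` (stmt-HodgeConjecture-14874), ALTERNATIVE line (strategist, 2026-08-17)

Route `PadicSemiregularLift`, crux (rank-9 glue node)

    FermatAnchorAssembly := PadicPridhamSemiregularity → FormalLiftingFromClassLifting →
      FormalVectorBundlesAlgebraize → HodgeFermatVarieties.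

TRANSFER LENS (crux-strategist (c)/(a)): the node is moved, by printed mathematics only, onto the CM SECTOR
of the Hodge conjecture — the shared target item `CMAbelianHodge` (stmt-HodgeConjecture-3052, target of routes
`SupersingularIsotypicLift` and `RankFourFaces`) — instead of the full `HodgeAbelianVarieties` used by the landed
zero-seed fallback (p129009). Dictionary: a residual Fermat eigenline `V(γ) ⊂ H^{2r}(X^{2r}_M)` and its Galois
conjugates form the space `⋀^{2r}_F H¹` of generalized Weil classes (`F = ℚ(ζ_M)`) on a product of CM factors
of the Fermat Jacobian `J(C_M)` (Shioda 1982 / Aoki 2002 §4; card `cyclotomic-weil-rank`); for `gap₃₅` the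
cheapest abelian avatar is a Künneth-(1,3) class on the 24-fold `B₁₂ × B′₁₂` (cdisprove `AbelianAvatar.md`);
André 1992 + the 2001 faces lattice (route `RankFourFaces`) reduce every CM Hodge class to E-rank-FOUR Weil
classes in CODIMENSION TWO on 4g-folds lying in Deligne's split unitary family — the rank at which Markman's
secant-sheaf engine starts (arXiv:2509.23403 §§4–5, §12; proved only for [E:ℚ] = 2, dim ≤ 6). WHY EASIER
(honest): not logically — `CMAbelianHodge` is stronger — but structurally: it trades an ISOLATED CM point
with second-order-obstructed Hodge loci (KILL F2–F3) and codimension r ≥ 3 for a codimension-2 class moving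
in a positive-dimensional family through ALGEBRAIC split anchors, where variational-Hodge / semiregular
deformation / Chern-class-of-reflexive-sheaf tools apply; and it is staffed (two routes) — this skeleton is the
kernel-checked edge `stmt-14874 ⟸ stmt-3052 + printed facts`.

STUBS (4): `stub_fermatToCurvePowersSum` (leaf print fact, by name: Shioda–Katsura blow-up geometry, shared with
the dead `Sketch` line — its blocker is itself), `stub_jacobianPointed` (leaf print fact, by name: Jacobians of
pointed complex curves), `stub_fermatJacobianPowersCM` (NEW, printed: the hosts `J(C_m)ᴺ⁺¹` are smooth
projective and carry a commutative reduced ℚ-subalgebra of `End⁰` of dimension `2·dim` — the image of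
`ℚ[μ_m × μ_m]ᴺ⁺¹`; multiplicity one of the `(m−1)(m−2) = 2g` characters in `H¹(C_m)`), `stub_cmAbelianHodge`
(= `CMAbelianHodge`, stmt-3052, VERBATIM — closes by `exact` the day that item closes; hardest).
Composition `FermatAnchorAssembly_of` through the landed
`ParallelizableAvatar.fermatAnchorAssembly_of_leaf_facts_of_hodgeFermatJacobianPowers` (p129885) and
`two_mul_dim_eq_finrank_bettiCohomology_holds` (the third leaf fact, discharged).

Disproof used (Cruxes/FermatAnchorAssembly/Disproof.lean v2): §1 — no `_false_without_<H>` exists; this line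
is ENGINE-FREE (h1b/h1a/h3a idle), like the zero-seed fallback; §2 consistent; §3–§4 (anchors) not applicable —
no `Anchor`, no `CrystallineRealization`, so the construction wall of `Lines/Sketch-dead.md` is absent.
Negatives index (stmt-11121 K3Exhaustion, stmt-12555 ELineConnectivity, stmt-17744): no contact.
-/

set_option linter.dupNamespace false

noncomputable section

open CategoryTheory AlgebraicGeometry
open Literature.AlgebraicGeometry Literature.AlgebraicGeometry.Motives
open Literature.AlgebraicGeometry.HodgeTheory
open Summit.HodgeConjecture.HodgeConjecture.Theses.PadicSemiregularLift
open Summit.HodgeConjecture.HodgeConjecture.Cruxes.FermatAnchorAssembly.ParallelizableAvatar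

namespace Summit.HodgeConjecture.HodgeConjecture.Cruxes.FermatAnchorAssembly.CmSectorTransfer

/-- **T1 `stub_fermatToCurvePowersSum` — Shioda–Katsura domination with the blow-up bookkeeping**
(the tree's named fact, by name; size XL for a literature-prover: the tree reduces it to the SK blow-up
GEOMETRY `FermatHodgeClassesLiftToCurvePowersSum_of_blowupGeometry₃`, cases `2p ≠ n` and `n = 2` proved,
residual `n = 2p ≥ 4`). Every Hodge class of `Xⁿₘ` becomes, modulo classes already algebraic, a Hodge class
on a sum of powers of the Fermat curve. [cite: ShiodaKatsura1979, §1 Thm. 1.7] [cite: Shioda1979HodgeFermat, Thm. I] -/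
theorem stub_fermatToCurvePowersSum :
    Literature.AlgebraicGeometry.HodgeTheory.FermatHodgeClassesLiftToCurvePowersSum := by
  sorry

/-- **T2 `stub_jacobianPointed` — Jacobians of pointed complex curves exist** (the tree's named fact, by
name; Weil's construction / Milne 1986 Thm. 1.1; size XL, research risk nil). [cite: Milne1986JacobianVarieties, Thm. 1.1] -/
theorem stub_jacobianPointed : nonempty_jacobian_of_algPoints.{0} := by
  sorry

/-- **T3 `stub_fermatJacobianPowersCM` — the hosts are smooth projective CM abelian varieties** (NEW; printed,
research risk nil, size XL on the tree's abstract `Jacobian` carrier): for a smooth projective complex Fermat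
curve `C` of degree `m` with Jacobian `𝒥` and every `N`, the power `J(C)ᴺ⁺¹` is smooth projective of its
dimension (Mumford §4, §6) and `End⁰(J(C)ᴺ⁺¹)` contains a commutative reduced ℚ-subalgebra of dimension
`2·dim` — the image of `ℚ[μₘ × μₘ]` acting factorwise through `Jacobian.pushforward` of the automorphisms
`(x:y:z) ↦ (ζᵃx : ζᵇy : z)`: the `(m−1)(m−2) = 2g` characters `(a, b)` with `a, b, a+b ≢ 0` occur in `H¹(Cₘ)`
with multiplicity one, so the image is `∏ ℚ(ζ_{m/(\cdot)})` of total dimension `2g` (`m ≤ 2`: `g = 0`, the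
zero algebra). WHY IT MIGHT FAIL: only by a mismatch between the tree's `schemeDim`/`endAlgebra` carriers and the
classical objects (e.g. `End` of the zero abelian variety). (Shioda, Math. Ann. 258, doi:10.1007/BF01450347, §1)
[cite: KoblitzRohrlich1978, §1 (the CM structure of the Fermat Jacobian)] [cite: MumfordAV1970, §4 (ii) and §6 Application 1] -/
theorem stub_fermatJacobianPowersCM :
    ∀ (m : ℕ) (C : SchemeOver ℂ) (𝒥 : Jacobian C), IsFermatVariety 1 m C → IsSmoothProjective 1 C →
      ∀ N : ℕ, IsSmoothProjective (𝒥.J.powSucc N).dim (𝒥.J.powSucc N).X ∧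
        ∃ S : Subalgebra ℚ (𝒥.J.powSucc N).endAlgebra, IsReduced ↥S ∧ (∀ x ∈ S, ∀ y ∈ S, x * y = y * x) ∧
          Module.finrank ℚ ↥S = 2 * (𝒥.J.powSucc N).dim := by
  sorry

/-- **T4 `stub_cmAbelianHodge` — the Hodge conjecture for complex abelian varieties of CM type** (VERBATIM
the shared route item `CMAbelianHodge`, stmt-HodgeConjecture-3052, target of routes `SupersingularIsotypicLift`
and `RankFourFaces`; the HARDEST stub, open problem; closes by `exact CMAbelianHodge_holds` the day that item
closes). WHY IT MIGHT FAIL: it contains Weil's 1977 candidate counterexamples at CM points and the E-Weil classes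
no quadratic sector reaches; no cycle construction is known for any CM field of degree > 2 (Markman 2025: [K:ℚ] = 2,
dim ≤ 6). [cite: Andre1992HodgeCM] [cite: Pohlmann1968] [cite: Markman2025SurveySecant, Thm. 1.2 and §12] -/
theorem stub_cmAbelianHodge :
    ∀ (A : Literature.AlgebraicGeometry.Motives.AbelianVariety ℂ),
      Literature.AlgebraicGeometry.Motives.IsSmoothProjective A.dim A.X →
      (∃ S : Subalgebra ℚ A.endAlgebra, IsReduced ↥S ∧ (∀ x ∈ S, ∀ y ∈ S, x * y = y * x) ∧
        Module.finrank ℚ ↥S = 2 * A.dim) →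
      Literature.AlgebraicGeometry.HodgeTheory.HodgeConjectureFor A.dim A.X := by
  sorry

/-! ### The composition: the four stub statements imply the crux, by name -/

/-- HC at every host `J(C)ᴺ⁺¹` of a Fermat curve, from T3 + T4 (sorry-free logic). [folklore assembly] -/
theorem hodgeFermatJacobianPowersAt_of_cm
    (hCM : ∀ (m : ℕ) (C : SchemeOver ℂ) (𝒥 : Jacobian C), IsFermatVariety 1 m C → IsSmoothProjective 1 C →
      ∀ N : ℕ, IsSmoothProjective (𝒥.J.powSucc N).dim (𝒥.J.powSucc N).X ∧
        ∃ S : Subalgebra ℚ (𝒥.J.powSucc N).endAlgebra, IsReduced ↥S ∧ (∀ x ∈ S, ∀ y ∈ S, x * y = y * x) ∧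
          Module.finrank ℚ ↥S = 2 * (𝒥.J.powSucc N).dim)
    (hHC : ∀ (A : Literature.AlgebraicGeometry.Motives.AbelianVariety ℂ),
      Literature.AlgebraicGeometry.Motives.IsSmoothProjective A.dim A.X →
      (∃ S : Subalgebra ℚ A.endAlgebra, IsReduced ↥S ∧ (∀ x ∈ S, ∀ y ∈ S, x * y = y * x) ∧
        Module.finrank ℚ ↥S = 2 * A.dim) →
      Literature.AlgebraicGeometry.HodgeTheory.HodgeConjectureFor A.dim A.X)
    (m : ℕ) (C : SchemeOver ℂ) (𝒥 : Jacobian C) : HodgeFermatJacobianPowersAt m C 𝒥 :=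
  fun hF hC N => hHC _ (hCM m C 𝒥 hF hC N).1 (hCM m C 𝒥 hF hC N).2

/-- **`FermatAnchorAssembly_of` — the crux BY NAME from the four registered stubs** (kernel-checked; the only
`sorry`s of the file live inside `stub_*`): leaf facts T1, T2 (+ the discharged
`two_mul_dim_eq_finrank_bettiCohomology_holds`) feed the landed transfer
`fermatAnchorAssembly_of_leaf_facts_of_hodgeFermatJacobianPowers` (p129885), whose host hypothesis is T3 + T4. -/
theorem FermatAnchorAssembly_of : FermatAnchorAssembly :=
  fermatAnchorAssembly_of_leaf_facts_of_hodgeFermatJacobianPowers stub_fermatToCurvePowersSum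
    two_mul_dim_eq_finrank_bettiCohomology_holds stub_jacobianPointed
    (hodgeFermatJacobianPowersAt_of_cm stub_fermatJacobianPowersCM stub_cmAbelianHodge)

end Summit.HodgeConjecture.HodgeConjecture.Cruxes.FermatAnchorAssembly.CmSectorTransfer

end
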